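import Mathlib

/-!
# Cheap irreducible factors: non-conjugate roots of an integer polynomial (kernel form)

Soloist file (informed mode, seat `solo-Schanuel-informed`, s179).  This is step (i) of the
ENDGAME LEMMA of the seat's note `paper/AE-note.md` §6 as kernel theorems: if a non-zero
`P ∈ ℤ[X]` has `k` pairwise NON-CONJUGATE complex roots `α` (pairwise distinct minimal
polynomials over `ℚ`), then these roots lie on `k` pairwise non-associated irreducible factors
`q_α ∈ ℤ[X]` of `P`, whose product divides `P`; hence `∑ deg q_α ≤ deg P` and
`∑ log M(q_α) ≤ log M(P)` (Mahler measure, every term `≥ 0`), and by MARKOV, as soon as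
`deg P / d₀ + log M(P) / h₀ < k`, some root `α` carries a CHEAP factor: `deg q_α ≤ d₀` and
`log M(q_α) ≤ h₀`.  In the note this is applied with `k ≥ 0.49 K` non-conjugate structured
roots (supplied by Lemma H, `soloCC_no_three_roots_in_rational_progression`), `d₀ = 10 D/K`,
`h₀ = 10 h′/K`.

Contents (prefix `soloCF_`):
* `soloCF_exists_factor_aeval_eq_zero` — a complex root of `P ≠ 0` is a root of some member of
  `UniqueFactorizationMonoid.factors P`;
* `soloCF_natDegree_pos_of_aeval_eq_zero` — an irreducible integer polynomial with a complex
  root has positive degree;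
* `soloCF_minpoly_eq_of_irreducible` — GAUSS + minimal polynomial: an irreducible `f ∈ ℤ[X]` of
  positive degree with `f(α) = 0` gives `minpoly ℚ α = f · C (lc f)⁻¹` (over `ℚ`);
* `soloCF_factor_family` — THE FAMILY: non-conjugate roots `α ∈ T` of `P` carry irreducible
  factors `q α ∣ P` of positive degree with `(q α)(α) = 0` and `∏_{α ∈ T} q α ∣ P`;
* `soloCF_mahlerMeasure_prod`, `soloCF_sum_natDegree_le`, `soloCF_sum_log_mahlerMeasure_le` —
  the two budget inequalities;
* `soloCF_exists_cheap` — the abstract Markov step (two non-negative costs, two budgets);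
* `soloCF_exists_cheap_factor` — THE LEMMA: `deg P / d₀ + log M(P) / h₀ < #T` gives `α ∈ T`
  and an irreducible `q ∣ P`, `q(α) = 0`, `0 < deg q ≤ d₀`, `log M(q) ≤ h₀`.

What this is NOT.  One elementary input of the seat's pen-and-paper THEOREM AE-1 on the node
`RoyAdditiveDirichletExponent` ([cite: Roy2010, Thm 1.1]; small value estimates for the
additive group); the endgame also needs the value estimate for the dilated factor `q(cT)` and
the tree's Gel'fond criterion, and the assembly with the served-set lemma
(`SoloInformedServedSet`), Lemma AE, Theorem C and Lemma H is not in the kernel.  Nothing here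
bears on `Literature.Periods.SchanuelConjecture` (the seat's verdict, no path, is unchanged).
The mathematics is classical (Gauss's lemma, unique factorisation in `ℤ[X]`, Mahler measure)
and claimed by no one as new; Mathlib-only, no definitions, no literature hypothesis; axioms
the standard three.
-/

namespace Summit.Schanuel.Schanuel.Theorems

open Finset Polynomial

section Factors

/-- A unit of `ℤ[X]` does not vanish at any complex number. -/
theorem soloCF_aeval_unit_ne_zero (u : ℤ[X]ˣ) (α : ℂ) : aeval α (u : ℤ[X]) ≠ 0 := by
  obtain ⟨r, hr, hru⟩ := Polynomial.isUnit_iff.mp u.isUnit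
  rw [← hru, aeval_C]
  rcases Int.isUnit_iff.mp hr with h | h <;> simp [h]

/-- A complex root of a non-zero integer polynomial is a root of one of its irreducible
factors (`UniqueFactorizationMonoid.factors`). -/
theorem soloCF_exists_factor_aeval_eq_zero (P : ℤ[X]) (hP : P ≠ 0) {α : ℂ}
    (hα : aeval α P = 0) : ∃ f ∈ UniqueFactorizationMonoid.factors P, aeval α f = 0 := by
  classical
  obtain ⟨u, hu⟩ := UniqueFactorizationMonoid.factors_prod hP
  have hprod : aeval α (UniqueFactorizationMonoid.factors P).prod = 0 := by
    have h := congrArg (aeval α) hu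
    rw [map_mul, hα] at h
    rcases mul_eq_zero.mp h with h | h
    · exact h
    · exact absurd h (soloCF_aeval_unit_ne_zero u α)
  rw [map_multiset_prod, Multiset.prod_eq_zero_iff, Multiset.mem_map] at hprod
  obtain ⟨f, hf, hf0⟩ := hprod
  exact ⟨f, hf, hf0⟩

/-- An irreducible integer polynomial with a complex root has positive degree. -/
theorem soloCF_natDegree_pos_of_aeval_eq_zero {f : ℤ[X]} (hf : Irreducible f) {α : ℂ}
    (hα : aeval α f = 0) : 0 < f.natDegree := by
  by_contra h
  have h0 : f.natDegree = 0 := by omega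
  rw [Polynomial.eq_C_of_natDegree_eq_zero h0, aeval_C] at hα
  have hc : f.coeff 0 = 0 := by
    have : ((f.coeff 0 : ℤ) : ℂ) = 0 := by simpa using hα
    exact_mod_cast this
  have hf0 : f = 0 := by rw [Polynomial.eq_C_of_natDegree_eq_zero h0, hc, C_0]
  exact hf.ne_zero hf0

/-- **Gauss + minimal polynomial.**  An irreducible `f ∈ ℤ[X]` of positive degree vanishing
at `α ∈ ℂ` determines the minimal polynomial of `α` over `ℚ`:
`minpoly ℚ α = f · C (lc f)⁻¹` (with `f` read in `ℚ[X]`). -/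
theorem soloCF_minpoly_eq_of_irreducible {f : ℤ[X]} (hf : Irreducible f) (hdeg : 0 < f.natDegree)
    {α : ℂ} (hα : aeval α f = 0) :
    minpoly ℚ α = f.map (Int.castRingHom ℚ) * C ((f.map (Int.castRingHom ℚ)).leadingCoeff)⁻¹ := by
  have hprim : f.IsPrimitive := hf.isPrimitive (Nat.pos_iff_ne_zero.mp hdeg)
  have hirr : Irreducible (f.map (Int.castRingHom ℚ)) := by
    rw [← algebraMap_int_eq]
    exact (hprim.irreducible_iff_irreducible_map_fraction_map (K := ℚ)).mp hf
  have hαQ : aeval α (f.map (Int.castRingHom ℚ)) = 0 := by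
    rw [← algebraMap_int_eq, aeval_map_algebraMap]
    exact hα
  exact (minpoly.eq_of_irreducible hirr hαQ).symm

/-- **The factor family.**  Pairwise non-conjugate complex roots `α ∈ T` of a non-zero
`P ∈ ℤ[X]` lie on irreducible factors `q α` of `P` of positive degree (`(q α)(α) = 0`,
`q α ∣ P`), and the product `∏_{α ∈ T} q α` divides `P` (the `q α` are pairwise
non-associated primes of the UFD `ℤ[X]`: associated factors would give `α`, `α'` the same
minimal polynomial over `ℚ`). -/
theorem soloCF_factor_family (P : ℤ[X]) (hP : P ≠ 0) (T : Finset ℂ)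
    (hroot : ∀ α ∈ T, aeval α P = 0)
    (hnc : ∀ α ∈ T, ∀ α' ∈ T, α ≠ α' → minpoly ℚ α ≠ minpoly ℚ α') :
    ∃ q : ℂ → ℤ[X],
      (∀ α ∈ T, Irreducible (q α) ∧ 0 < (q α).natDegree ∧ aeval α (q α) = 0 ∧ q α ∣ P) ∧
      (∏ α ∈ T, q α) ∣ P := by
  classical
  have hex : ∀ α ∈ T, ∃ f, f ∈ UniqueFactorizationMonoid.factors P ∧ aeval α f = 0 := by
    intro α hα
    obtain ⟨f, hf, h0⟩ := soloCF_exists_factor_aeval_eq_zero P hP (hroot α hα)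
    exact ⟨f, hf, h0⟩
  choose! q hq using hex
  have hirr : ∀ α ∈ T, Irreducible (q α) := fun α hα =>
    UniqueFactorizationMonoid.irreducible_of_factor _ (hq α hα).1
  have hdeg : ∀ α ∈ T, 0 < (q α).natDegree := fun α hα =>
    soloCF_natDegree_pos_of_aeval_eq_zero (hirr α hα) (hq α hα).2
  refine ⟨q, fun α hα => ⟨hirr α hα, hdeg α hα, (hq α hα).2,
    UniqueFactorizationMonoid.dvd_of_mem_factors (hq α hα).1⟩, ?_⟩
  rw [Finset.prod_eq_multiset_prod]
  apply Multiset.prod_primes_dvd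
  · intro a ha
    rw [Multiset.mem_map] at ha
    obtain ⟨α, hα, rfl⟩ := ha
    exact UniqueFactorizationMonoid.prime_of_factor _ (hq α hα).1
  · intro a ha
    rw [Multiset.mem_map] at ha
    obtain ⟨α, hα, rfl⟩ := ha
    exact UniqueFactorizationMonoid.dvd_of_mem_factors (hq α hα).1
  · intro a
    rw [Multiset.countP_map]
    have hfin : (Multiset.filter (fun α => Associated a (q α)) T.val).card =
        #(T.filter (fun α => Associated a (q α))) := by
      rw [← Finset.filter_val, Finset.card_val]
    rw [hfin]
    refine Finset.card_le_one.mpr (fun α hα α' hα' => ?_)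
    rw [Finset.mem_filter] at hα hα'
    by_contra hne
    apply hnc α hα.1 α' hα'.1 hne
    obtain ⟨u, hu⟩ := hα.2.symm.trans hα'.2
    have hα'root : aeval α' (q α) = 0 := by
      have h := (hq α' hα'.1).2
      rw [← hu, map_mul] at h
      rcases mul_eq_zero.mp h with h | h
      · exact h
      · exact absurd h (soloCF_aeval_unit_ne_zero u α')
    rw [soloCF_minpoly_eq_of_irreducible (hirr α hα.1) (hdeg α hα.1) (hq α hα.1).2,
      soloCF_minpoly_eq_of_irreducible (hirr α hα.1) (hdeg α hα.1) hα'root]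

end Factors

section Budgets

/-- The Mahler measure of a finite product of complex polynomials is the product of the
Mahler measures. -/
theorem soloCF_mahlerMeasure_prod {ι : Type*} (T : Finset ι) (g : ι → ℂ[X]) :
    (∏ i ∈ T, g i).mahlerMeasure = ∏ i ∈ T, (g i).mahlerMeasure := by
  classical
  induction T using Finset.induction_on with
  | empty => simp
  | insert a s ha ih => rw [Finset.prod_insert ha, Finset.prod_insert ha, mahlerMeasure_mul, ih]

/-- Degree budget: if `∏_{α ∈ T} q α ∣ P ≠ 0` then `∑ deg (q α) ≤ deg P`. -/
theorem soloCF_sum_natDegree_le (P : ℤ[X]) (hP : P ≠ 0) (T : Finset ℂ) (q : ℂ → ℤ[X])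
    (hdvd : (∏ α ∈ T, q α) ∣ P) : ∑ α ∈ T, (q α).natDegree ≤ P.natDegree := by
  have hq0 : ∀ α ∈ T, q α ≠ 0 := by
    intro α hα h0
    obtain ⟨H, hH⟩ := hdvd
    apply hP
    rw [hH, Finset.prod_eq_zero hα h0, zero_mul]
  rw [← Polynomial.natDegree_prod _ _ hq0]
  exact Polynomial.natDegree_le_of_dvd hdvd hP

/-- Height budget: if `∏_{α ∈ T} q α ∣ P ≠ 0` then `∑ log M(q α) ≤ log M(P)` (complex Mahler
measures of the images; the cofactor is a non-zero integer polynomial, so its Mahler measure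
is `≥ 1`). -/
theorem soloCF_sum_log_mahlerMeasure_le (P : ℤ[X]) (hP : P ≠ 0) (T : Finset ℂ) (q : ℂ → ℤ[X])
    (hdvd : (∏ α ∈ T, q α) ∣ P) :
    ∑ α ∈ T, Real.log ((q α).map (Int.castRingHom ℂ)).mahlerMeasure ≤
      Real.log (P.map (Int.castRingHom ℂ)).mahlerMeasure := by
  obtain ⟨H, hH⟩ := hdvd
  have hH0 : H ≠ 0 := by
    rintro rfl
    exact hP (by rw [hH, mul_zero])
  have hq0 : ∀ α ∈ T, q α ≠ 0 := by
    intro α hα h0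
    apply hP
    rw [hH, Finset.prod_eq_zero hα h0, zero_mul]
  have hM : (P.map (Int.castRingHom ℂ)).mahlerMeasure =
      (∏ α ∈ T, ((q α).map (Int.castRingHom ℂ)).mahlerMeasure) *
        (H.map (Int.castRingHom ℂ)).mahlerMeasure := by
    rw [hH, Polynomial.map_mul, mahlerMeasure_mul, Polynomial.map_prod, soloCF_mahlerMeasure_prod]
  have hpos : ∀ α ∈ T, 0 < ((q α).map (Int.castRingHom ℂ)).mahlerMeasure := fun α hα =>
    zero_lt_one.trans_le (Polynomial.one_le_mahlerMeasure_of_ne_zero (hq0 α hα))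
  have hH1 : 1 ≤ (H.map (Int.castRingHom ℂ)).mahlerMeasure :=
    Polynomial.one_le_mahlerMeasure_of_ne_zero hH0
  rw [hM, Real.log_mul (Finset.prod_pos hpos).ne' (zero_lt_one.trans_le hH1).ne',
    Real.log_prod (fun α hα => (hpos α hα).ne')]
  linarith [Real.log_nonneg hH1]

/-- **Abstract Markov step.**  Two non-negative costs on a finite set with total budgets
`Dtot`, `Htot`; if `Dtot / d₀ + Htot / h₀ < #T` then some element is cheap for both. -/
theorem soloCF_exists_cheap {ι : Type*} (T : Finset ι) (deg ht : ι → ℝ)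
    (hdeg0 : ∀ α ∈ T, 0 ≤ deg α) (hht0 : ∀ α ∈ T, 0 ≤ ht α) {Dtot Htot d₀ h₀ : ℝ}
    (hd₀ : 0 < d₀) (hh₀ : 0 < h₀) (hsumd : ∑ α ∈ T, deg α ≤ Dtot)
    (hsumh : ∑ α ∈ T, ht α ≤ Htot) (hT : Dtot / d₀ + Htot / h₀ < #T) :
    ∃ α ∈ T, deg α ≤ d₀ ∧ ht α ≤ h₀ := by
  by_contra hno
  push Not at hno
  have hterm : ∀ α ∈ T, (1 : ℝ) ≤ deg α / d₀ + ht α / h₀ := by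
    intro α hα
    by_cases h : deg α ≤ d₀
    · have h1 : 1 ≤ ht α / h₀ := by
        rw [le_div_iff₀ hh₀]
        linarith [hno α hα h]
      linarith [div_nonneg (hdeg0 α hα) hd₀.le]
    · have h1 : 1 ≤ deg α / d₀ := by
        rw [le_div_iff₀ hd₀]
        linarith [not_le.mp h]
      linarith [div_nonneg (hht0 α hα) hh₀.le]
  have hsum : (#T : ℝ) ≤ ∑ α ∈ T, (deg α / d₀ + ht α / h₀) := by
    calc (#T : ℝ) = ∑ _α ∈ T, (1 : ℝ) := by simp
      _ ≤ _ := Finset.sum_le_sum hterm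
  rw [Finset.sum_add_distrib, ← Finset.sum_div, ← Finset.sum_div] at hsum
  have h3 : (∑ α ∈ T, deg α) / d₀ ≤ Dtot / d₀ := div_le_div_of_nonneg_right hsumd hd₀.le
  have h4 : (∑ α ∈ T, ht α) / h₀ ≤ Htot / h₀ := div_le_div_of_nonneg_right hsumh hh₀.le
  linarith

end Budgets

section Cheap

/-- **Cheap irreducible factor** (AE-note §6 (i), kernel form).  `P ∈ ℤ[X]`, `P ≠ 0`; `T` a
finite set of pairwise non-conjugate complex roots of `P`; `0 < d₀`, `0 < h₀` with
`deg P / d₀ + log M(P) / h₀ < #T`.  Then some `α ∈ T` is a root of an irreducible factor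
`q ∣ P` in `ℤ[X]` with `0 < deg q ≤ d₀` and `log M(q) ≤ h₀`. -/
theorem soloCF_exists_cheap_factor (P : ℤ[X]) (hP : P ≠ 0) (T : Finset ℂ)
    (hroot : ∀ α ∈ T, aeval α P = 0)
    (hnc : ∀ α ∈ T, ∀ α' ∈ T, α ≠ α' → minpoly ℚ α ≠ minpoly ℚ α') {d₀ h₀ : ℝ}
    (hd₀ : 0 < d₀) (hh₀ : 0 < h₀)
    (hT : P.natDegree / d₀ + Real.log (P.map (Int.castRingHom ℂ)).mahlerMeasure / h₀ < #T) :
    ∃ α ∈ T, ∃ q : ℤ[X], Irreducible q ∧ 0 < q.natDegree ∧ q ∣ P ∧ aeval α q = 0 ∧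
      (q.natDegree : ℝ) ≤ d₀ ∧ Real.log (q.map (Int.castRingHom ℂ)).mahlerMeasure ≤ h₀ := by
  obtain ⟨q, hq, hdvd⟩ := soloCF_factor_family P hP T hroot hnc
  have hsumd : ∑ α ∈ T, ((q α).natDegree : ℝ) ≤ P.natDegree := by
    exact_mod_cast soloCF_sum_natDegree_le P hP T q hdvd
  have hsumh := soloCF_sum_log_mahlerMeasure_le P hP T q hdvd
  obtain ⟨α, hα, hd, hh⟩ := soloCF_exists_cheap T (fun α => ((q α).natDegree : ℝ))
    (fun α => Real.log ((q α).map (Int.castRingHom ℂ)).mahlerMeasure)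
    (fun _ _ => Nat.cast_nonneg _)
    (fun α hα => Real.log_nonneg
      (Polynomial.one_le_mahlerMeasure_of_ne_zero (hq α hα).1.ne_zero))
    hd₀ hh₀ hsumd hsumh hT
  exact ⟨α, hα, q α, (hq α hα).1, (hq α hα).2.1, (hq α hα).2.2.2, (hq α hα).2.2.1, hd, hh⟩

end Cheap

end Summit.Schanuel.Schanuel.Theorems
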